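/-
Copyright: the b2b-balaban T⁴-continuum CRUX team, row NE7b OWNER lineage `t4-ne7b-p1` (gen 134). Project licence.
-/
import Summits.QuantumFields.BalabanUV.T4Continuum.Spine.NE7b.SupLargeSetSeparation

/-!
# LIPSCHITZ POTENTIALS BOUND THE GRAPH DISTANCE FROM BELOW — THE COORDINATE FORM OF (362)'S DISTANCE HYPOTHESIS: for any integer potential `φ`
# that moves by at most one across every `R`-edge, `|φ x − φ y| ≤ dist_{fromRel R}(x, y)` for reachable `x, y` (induction on a shortest walk); so
# «cells of distinct non-adjacent blocks are `≥ 2r + 1` apart in the cell graph» follows from «they differ by `≥ 2r + 1` in SOME `R`-Lipschitz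
# potential» — the form that is checked coordinate by coordinate for cubes on the torus (the potential `a ↦ |valMinAbs (a_i − y_i)|` is
# Lipschitz under `ℓ^∞`-steps by (132)'s `natAbs_valMinAbs_add_one_le` and separates non-adjacent cubes by `≥ L + 1`), and (362)'s
# `largeSet_separation` restated under that coordinate hypothesis (row NE7b, node U5c; (362) + Mathlib's `Reachable.exists_walk_length_eq_dist`,
# walk induction BY NAME; [folklore])

Cell `pub-balaban`, sub-cell `t4`, spine estimate NE7b (`T4WeightBudget.RelWeightBound`; the cell's OWN estimate — NOT PRINTED in
[Bałaban 1983–89], NOT PROVED).  Crux-route work under `Spine/NE7b/` by the row OWNER (`t4-ne7b-p1` gen 134, file (365)) under FREEZE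
(0)'s crux-prover clause, on `g134/records/SCOPING-d6-iteration.md` DECISION (4) (one step closer to the torus instance of the blocking
regeneration); NOTHING of Bałaban's is named as a Lean object, valued or asserted; no `T4Continuum/Support` leaf typed; no `def`, no notation;
zero `sorry`.  Imports (BY NAME): the OWNER's (362) `…SupLargeSetSeparation` (`largeSet_separation`, `reachable_of_mem_rconnected`); Mathlib's
`SimpleGraph.Walk` (`length_nil`, `length_cons`), `SimpleGraph.fromRel_adj`, `Reachable.exists_walk_length_eq_dist`.

WHAT IS PROVED ([folklore]; `d = (SimpleGraph.fromRel R).dist`):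
* §1 **`abs_sub_le_length`** (along any walk of the generated graph an `R`-Lipschitz integer potential moves by at most the length),
  **`abs_sub_le_dist`** (`|φ x − φ y| ≤ d x y` for reachable `x, y`), `le_dist_of_potential` (a potential gap `≥ n` forces `n ≤ d x y`);
* §2 THE END **`largeSet_separation_of_potentials`** ((362)'s large-set separation `⌊(r+1)∕(Δ'+1)⌋·(#B(Y) − (Δ'+1)) + 1 ≤ #Y` for every
  `R`-connected `Y`, under: for cells `x, y ∈ Y` in distinct non-adjacent blocks SOME `R`-Lipschitz integer potential has `|φ x − φ y| ≥ 2r + 1`); §3 toy.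

HONEST (what this is NOT).  Graph combinatorics; the torus instance itself (cells = torus blocks with `ℓ^∞` adjacency, blocks of side `L`, the
coordinate potentials `|valMinAbs(· − y_i)|`) is the successor's short step; scalar skeleton ((A3), NC-NE7b-α UNRULED); nothing of Bałaban's
asserted.  BY-NAME EFFECT ON THE WALL: NONE.  NE7b NOT PRINTED ∕ NOT PROVED; spine PROVED 0∕9; rung (B)+1 — the programme's measures remain
FINITE-torus statements; NOT the mass gap, NOT Clay.  HONEST DEPENDENCY: continuum YM on T⁴ ⇐ BetaPertH ∧ nine spine estimates (0∕9 proved);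
BetaPertH ⇐ (D1) ∧ (D4) ∧ CAP+tail; G-an2-4 gates asym, D1 and NE2∕3∕4.
-/

set_option autoImplicit false

namespace Summit.QuantumFields.BalabanUV.T4Continuum.NE7b.SupGraphDistanceLipschitz

open Finset
open Literature.Probability.LatticeModels
open SupLargeSetSeparation (largeSet_separation reachable_of_mem_rconnected)

variable {V W : Type*} [DecidableEq V] [DecidableEq W] {R : V → V → Prop} {R' : W → W → Prop}

/-! ## §1. Lipschitz potentials and the graph distance -/

omit [DecidableEq V] in
/-- **Along a walk an `R`-Lipschitz integer potential moves by at most the length of the walk.** [folklore] -/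
theorem abs_sub_le_length (φ : V → ℤ) (hφ : ∀ a b, R a b → |φ a - φ b| ≤ 1) :
    ∀ {u v : V} (p : (SimpleGraph.fromRel R).Walk u v), |φ u - φ v| ≤ p.length := by
  intro u v p
  induction p with
  | nil => simp
  | @cons a b c hab p ih =>
      rw [SimpleGraph.Walk.length_cons]
      have hstep : |φ a - φ b| ≤ 1 := by
        rcases ((SimpleGraph.fromRel_adj R a b).1 hab).2 with h | h
        · exact hφ a b h
        · rw [abs_sub_comm]; exact hφ b a h
      have htri : |φ a - φ c| ≤ |φ a - φ b| + |φ b - φ c| := abs_sub_le _ _ _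
      push_cast
      linarith

omit [DecidableEq V] in
/-- **`|φ x − φ y| ≤ dist x y`** for reachable `x, y` and an `R`-Lipschitz integer potential `φ`. [folklore] -/
theorem abs_sub_le_dist (φ : V → ℤ) (hφ : ∀ a b, R a b → |φ a - φ b| ≤ 1) {x y : V} (hxy : (SimpleGraph.fromRel R).Reachable x y) :
    |φ x - φ y| ≤ (SimpleGraph.fromRel R).dist x y := by
  obtain ⟨p, hp⟩ := hxy.exists_walk_length_eq_dist
  rw [← hp]
  exact abs_sub_le_length φ hφ p

omit [DecidableEq V] in
/-- **A potential gap forces distance**: `n ≤ |φ x − φ y|` for some `R`-Lipschitz integer potential ⟹ `n ≤ dist x y` (reachable `x, y`). [folklore] -/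
theorem le_dist_of_potential {x y : V} (hxy : (SimpleGraph.fromRel R).Reachable x y) {n : ℕ}
    (h : ∃ φ : V → ℤ, (∀ a b, R a b → |φ a - φ b| ≤ 1) ∧ (n : ℤ) ≤ |φ x - φ y|) : n ≤ (SimpleGraph.fromRel R).dist x y := by
  obtain ⟨φ, hφ, hn⟩ := h
  exact_mod_cast hn.trans (abs_sub_le_dist φ hφ hxy)

/-! ## §2. THE END: the large-set separation from coordinate potentials -/

/-- **THE LARGE-SET SEPARATION FROM LIPSCHITZ POTENTIALS.**  `Y` an `R`-connected cell set; a block map `B : V → W` with a symmetric block adjacency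
`R'` of `≤ Δ'` neighbours; for cells `x, y ∈ Y` in distinct non-adjacent blocks SOME `R`-Lipschitz integer potential separates them by `≥ 2r + 1` ⟹
`⌊(r+1)∕(Δ'+1)⌋·(#B(Y) − (Δ'+1)) + 1 ≤ #Y` ((362) BY NAME; the cells of `Y` are mutually reachable). [folklore] -/
theorem largeSet_separation_of_potentials {Y : Finset V} (hY : IsRConnected R Y) (B : V → W) (hR' : ∀ a b, R' a b → R' b a)
    {nbr' : W → Finset W} {Δ' : ℕ} (hΔ' : ∀ a, (nbr' a).card ≤ Δ') (hnbr' : ∀ a b, R' a b → b ∈ nbr' a) {r : ℕ}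
    (hcoord : ∀ x ∈ Y, ∀ y ∈ Y, B x ≠ B y → ¬ R' (B x) (B y) →
      ∃ φ : V → ℤ, (∀ a b, R a b → |φ a - φ b| ≤ 1) ∧ ((2 * r + 1 : ℕ) : ℤ) ≤ |φ x - φ y|) :
    (r + 1) / (Δ' + 1) * ((Y.image B).card - (Δ' + 1)) + 1 ≤ Y.card :=
  largeSet_separation hY B hR' hΔ' hnbr' fun x hx y hy hB hR'B =>
    le_dist_of_potential (reachable_of_mem_rconnected hY hx hy) (hcoord x hx y hy hB hR'B)

/-! ## §3. Toy -/

omit [DecidableEq V] in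
/-- Toy (§1): along the TRIVIAL walk a Lipschitz potential does not move: `|φ u − φ u| ≤ 0`. -/
example (φ : V → ℤ) (hφ : ∀ a b, R a b → |φ a - φ b| ≤ 1) (u : V) :
    |φ u - φ u| ≤ ((SimpleGraph.Walk.nil : (SimpleGraph.fromRel R).Walk u u).length : ℤ) :=
  abs_sub_le_length φ hφ _

end Summit.QuantumFields.BalabanUV.T4Continuum.NE7b.SupGraphDistanceLipschitz
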